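import Summits.QuantumAdvantage.AdviceFreeQNC0.CommonGatesHardPolylog
import Summits.QuantumAdvantage.AdviceFreeQNC0.GatedLocal37
import HarnessLib

/-!
# Cell qa-qnc0, `p = 3` — the rung (J1-polylog) in the cell's other two vocabularies

`CommonGatesHardPolylog.commonGatesHardPolylog` (g23) in the shapes used by planner qa-qnc0-p1:

* `gatesHardPolylog : GatesHardPolylog` — p1 g37's `BlockFibre37.GatesHardConst` / `GatesHardLog` shape (a selector `f : (𝔽₃)^K → T`
  into an arbitrary index type `T`, window-local branches `G t`), now for ALL `K ≤ (log₂ n)^C` gates (p1: constant `k`, resp. `3^r(log₂n)^{2C+2} ≤ n`);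
* `gatedLocalHardPolylog : GatedLocalHardPolylog` — p1 g36's `AffBells37G.GatedLocal r k` vocabulary (`GatedLocal37.lean`): gated-local strategies with
  `k ≤ (log₂ n)^C` gates and `(log₂ n)^C` windows win `≤ θ·2ⁿ`, every charge (the tree had `GatedLocalHardU k` for each FIXED `k`, g23).

WHAT THIS IS NOT: nothing beyond `commonGatesHardPolylog`; crux 22907 untouched; no separation.
-/

noncomputable section

namespace Summit.QuantumAdvantage.AdviceFreeQNC0

open Finset

namespace BondTwist3

open BlockFibre37 (gateSum)

/-- **(G_polylog)**: p1's `GatesHardConst` shape with `K ≤ (log₂ n)^C` common gates feeding an arbitrary selector `f` into window-local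
branches `G t`. -/
def GatesHardPolylog : Prop :=
  ∃ θ : ℝ, θ < 1 ∧ ∀ C : ℕ, ∃ n₀ : ℕ, ∀ n ≥ n₀, ∀ K ≤ Nat.log 2 n ^ C, ∀ (ℓ : Fin K → Fin (n + 1) → ZMod 3) (c : ℕ) (T : Type)
    (f : (Fin K → ZMod 3) → T) (G : T → Fin (n + 1) → (Fin n → Bool) → Bool),
    (∀ t, WindowLocal ((Nat.log 2 n) ^ C) (G t)) →
    ((univ.filter fun u : Fin n → Bool =>
        ringWinU c (fun g u => G (f (fun i => gateSum (ℓ i) u)) g u) u = true).card : ℝ) ≤ θ * (2 : ℝ) ^ n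

/-- **`gatesHardPolylog : GatesHardPolylog` — PROVED** (`F g v u := G (f v) g u` in `commonGatesHardPolylog`). -/
theorem gatesHardPolylog : GatesHardPolylog := by
  obtain ⟨θ, hθ, H⟩ := commonGatesHardPolylog
  refine ⟨θ, hθ, fun C => ?_⟩
  obtain ⟨n₀, hn₀⟩ := H C
  refine ⟨n₀, fun n hn K hK ℓ c T f G hG => ?_⟩
  exact hn₀ n hn K hK ℓ c (fun g v u => G (f v) g u) fun t => hG (f t)

end BondTwist3

namespace AffBells37G

/-- **`GatedLocalHardPolylog`**: gated-local strategies with `k ≤ (log₂ n)^C` global MOD₃ gates and `(log₂ n)^C` windows win the walk game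
(every charge) on at most `θ·2ⁿ`, one `θ < 1` for all `C`. -/
def GatedLocalHardPolylog : Prop :=
  ∃ θ : ℝ, θ < 1 ∧ ∀ C : ℕ, ∃ n₀ : ℕ, ∀ n ≥ n₀, ∀ k ≤ Nat.log 2 n ^ C, ∀ c : ℕ, ∀ y : Fin (n + 1) → (Fin n → Bool) → Bool,
    GatedLocal ((Nat.log 2 n) ^ C) k y →
      ((univ.filter fun u : Fin n → Bool => ringWinU c y u = true).card : ℝ) ≤ θ * (2 : ℝ) ^ n

/-- **`gatedLocalHardPolylog : GatedLocalHardPolylog` — PROVED** (`gateVal ≡ gateSum`; unpack `GatedLocal` into `commonGatesHardPolylog`). -/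
theorem gatedLocalHardPolylog : GatedLocalHardPolylog := by
  obtain ⟨θ, hθ, H⟩ := BondTwist3.commonGatesHardPolylog
  refine ⟨θ, hθ, fun C => ?_⟩
  obtain ⟨n₀, hn₀⟩ := H C
  refine ⟨n₀, fun n hn k hk c y hy => ?_⟩
  obtain ⟨ℓ, G, hG, hyG⟩ := hy
  have hy' : y = fun g u => G (fun i => gateVal (ℓ i) u) g u := funext fun g => funext fun u => hyG g u
  subst hy'
  exact hn₀ n hn k hk ℓ c (fun g v u => G v g u) hG

end AffBells37G

end Summit.QuantumAdvantage.AdviceFreeQNC0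

end
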